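import Mathlib
import HarnessLib
import Summits.Ventures.LatticeQCDFlow.Exactness.IMHDelayedRejectionExact
import Summits.Ventures.LatticeQCDFlow.Exactness.FlowSamplerFluxCone

/-!
# LatticeQCDFlow / Exactness — THREE CHANCES: the three-stage delayed-rejection flow sampler (a third independent flow draw after two priced
# rejections, accepted with the third-stage Tierney–Mira ∕ Mira ratio) is exact on a general state space — an instance of the flux cone

HONEST FRAMING: exact (Metropolis-corrected) sampling algorithms for lattice gauge theory;
figures of merit are autocorrelation/cost numbers at stated couplings and volumes; no
continuum-physics claim.

Venture `LatticeQCDFlow` (cell pub-lqcd), topic `Exactness`, FANOUT row 30 (lean-1 GEN-43, parts I + III: `IMHDelayedRejectionExact` gives the first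
two stages, `FlowSamplerFluxCone` the principle).  NEW WORK of the cell; no definition is introduced, nothing is cited as a fact.  Printed counterpart
NAMED ONLY: Mira, "On Metropolis–Hastings algorithms with delayed rejection", Metron 59 (2001) (the `k`-stage ratio: the probability of the whole
rejected prefix from the candidate over that from the current state).

## The sampler (general measurable `Ω`; flow law `q`; weight `w > 0`; `π = w·q`; `a`, `A`, `d = d₂` as in `IMHDelayedRejectionExact`)

Residual after two stages from a state `u`, given the two rejected draws `η = (y₁, y₂)`: `r(u; η) = (1 − a(u, y₁)) − d₂(u, y₁, y₂) ≥ 0` — the probability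
of having rejected both.  Third-stage product density: `d₃(x; η; z) = min(r(x; η), r(z; η)·w(z)/w(x))` = `r(x; η)` × the third-stage acceptance
`min(1, w(z)r(z; η) / (w(x)r(x; η)))`.  Def-free: ANY kernel `K` with landing density
`ã(x, z) = [a(x, z) + ∫ d₂(x, y₁, z) dq(y₁)] + ∫∫ d₃(x; (y₁, y₂); z) dq(y₁) dq(y₂)` and `K(x, B) = ∫_B ã(x, z) dq + (1 − ∫ ã(x, ·) dq)·1_B(x)` (hypothesis `hK`).

## Results [all ours]

* `residual₂_nonneg`, `measurable_residual₂`: bookkeeping of the two-stage residual.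
* **`threeStage_isReversible` ∕ `threeStage_invariant`**: EVERY such kernel is `π`-reversible and (when Markov) leaves `π = w·q` invariant — by
  `fluxCone_isReversible` with the flux-symmetric two-stage density of `IMHDelayedRejectionExact` as `b` and the residual-min atom over
  `η ∼ q ⊗ q` as the third stage.
* `residual₂_add_drSecond`: `r(u; η) + d₂(u, y₁, y₂) = 1 − a(u, y₁)`; **`threeStage_mass_le_one`**: the landing mass is at most one, so a Markov
  kernel realising `hK` exists as in `IMHDelayedRejectionKernel`.  Further stages iterate the same two lines (residual ↦ residual − new stage).
-/

namespace Summit.Ventures.LatticeQCDFlow.Exactness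

open MeasureTheory ProbabilityTheory
open scoped ENNReal

variable {Ω : Type*} [MeasurableSpace Ω] {q : Measure Ω} [IsProbabilityMeasure q] {w : Ω → ℝ}

/-! ## §1 The two-stage residual -/

omit [MeasurableSpace Ω] in
/-- `r(u; y₁, y₂) = (1 − a(u, y₁)) − d₂(u, y₁, y₂) ≥ 0`. [ours, bookkeeping] -/
theorem residual₂_nonneg (u y₁ y₂ : Ω) :
    0 ≤ (1 - imhAccept w u y₁) - min (1 - imhAccept w u y₁) (w y₂ * (1 - imhAccept w y₂ y₁) / w u) :=
  sub_nonneg.2 (min_le_left _ _)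

omit [MeasurableSpace Ω] in
/-- **`r + d₂ = 1 − a`**: the second stage and the two-stage residual partition the first-stage rejection probability. [ours] -/
theorem residual₂_add_drSecond (hw0 : ∀ x, 0 < w x) (u y₁ y₂ : Ω) :
    ENNReal.ofReal ((1 - imhAccept w u y₁) - min (1 - imhAccept w u y₁) (w y₂ * (1 - imhAccept w y₂ y₁) / w u)) +
        ENNReal.ofReal (min (1 - imhAccept w u y₁) (w y₂ * (1 - imhAccept w y₂ y₁) / w u)) =
      1 - imhAcceptE w u y₁ := by
  rw [← ENNReal.ofReal_add (residual₂_nonneg u y₁ y₂) (drSecond_nonneg hw0 u y₁ y₂), sub_add_cancel, imhAcceptE,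
    ENNReal.ofReal_sub _ (imhAccept_nonneg hw0 u y₁), ENNReal.ofReal_one]

/-- Joint measurability of the residual `(u, (y₁, y₂)) ↦ r(u; y₁, y₂)`. [ours, bookkeeping] -/
theorem measurable_residual₂ (hw : Measurable w) :
    Measurable (Function.uncurry fun (u : Ω) (η : Ω × Ω) =>
      ENNReal.ofReal ((1 - imhAccept w u η.1) - min (1 - imhAccept w u η.1) (w η.2 * (1 - imhAccept w η.2 η.1) / w u))) := by
  unfold imhAccept
  have h1 : Measurable fun p : Ω × (Ω × Ω) => w p.1 := hw.comp measurable_fst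
  have h2 : Measurable fun p : Ω × (Ω × Ω) => w p.2.1 := hw.comp (measurable_fst.comp measurable_snd)
  have h3 : Measurable fun p : Ω × (Ω × Ω) => w p.2.2 := hw.comp (measurable_snd.comp measurable_snd)
  exact ((measurable_const.sub (measurable_const.min (h2.div h1))).sub
    ((measurable_const.sub (measurable_const.min (h2.div h1))).min
      ((h3.mul (measurable_const.sub (measurable_const.min (h2.div h3)))).div h1))).ennreal_ofReal

/-! ## §2 Exactness by the flux cone -/

/-- **THE THREE-STAGE DELAYED-REJECTION FLOW SAMPLER IS EXACT — DETAILED BALANCE.** [ours] -/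
theorem threeStage_isReversible (hw : Measurable w) (hw0 : ∀ x, 0 < w x) (K : Kernel Ω Ω)
    (hK : ∀ (x : Ω) {B : Set Ω}, MeasurableSet B → K x B =
      ∫⁻ z in B, ((imhAcceptE w x z +
          ∫⁻ y₁, ENNReal.ofReal (min (1 - imhAccept w x y₁) (w z * (1 - imhAccept w z y₁) / w x)) ∂q) +
        ∫⁻ η, min (ENNReal.ofReal ((1 - imhAccept w x η.1) - min (1 - imhAccept w x η.1) (w η.2 * (1 - imhAccept w η.2 η.1) / w x)))
          (ENNReal.ofReal (w z / w x) *
            ENNReal.ofReal ((1 - imhAccept w z η.1) - min (1 - imhAccept w z η.1) (w η.2 * (1 - imhAccept w η.2 η.1) / w z)))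
          ∂(q.prod q)) ∂q +
      (1 - ∫⁻ z, ((imhAcceptE w x z +
          ∫⁻ y₁, ENNReal.ofReal (min (1 - imhAccept w x y₁) (w z * (1 - imhAccept w z y₁) / w x)) ∂q) +
        ∫⁻ η, min (ENNReal.ofReal ((1 - imhAccept w x η.1) - min (1 - imhAccept w x η.1) (w η.2 * (1 - imhAccept w η.2 η.1) / w x)))
          (ENNReal.ofReal (w z / w x) *
            ENNReal.ofReal ((1 - imhAccept w z η.1) - min (1 - imhAccept w z η.1) (w η.2 * (1 - imhAccept w η.2 η.1) / w z)))
          ∂(q.prod q)) ∂q) * B.indicator 1 x) :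
    Kernel.IsReversible K (q.withDensity fun x => ENNReal.ofReal (w x)) :=
  fluxCone_isReversible (q.prod q) hw hw0 (measurable_drDensity q hw) (drDensity_flux_symm hw hw0) (measurable_residual₂ hw) K hK

/-- **… INVARIANCE** when `K` is Markov. [ours] -/
theorem threeStage_invariant (hw : Measurable w) (hw0 : ∀ x, 0 < w x) (K : Kernel Ω Ω) [IsMarkovKernel K]
    (hK : ∀ (x : Ω) {B : Set Ω}, MeasurableSet B → K x B =
      ∫⁻ z in B, ((imhAcceptE w x z +
          ∫⁻ y₁, ENNReal.ofReal (min (1 - imhAccept w x y₁) (w z * (1 - imhAccept w z y₁) / w x)) ∂q) +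
        ∫⁻ η, min (ENNReal.ofReal ((1 - imhAccept w x η.1) - min (1 - imhAccept w x η.1) (w η.2 * (1 - imhAccept w η.2 η.1) / w x)))
          (ENNReal.ofReal (w z / w x) *
            ENNReal.ofReal ((1 - imhAccept w z η.1) - min (1 - imhAccept w z η.1) (w η.2 * (1 - imhAccept w η.2 η.1) / w z)))
          ∂(q.prod q)) ∂q +
      (1 - ∫⁻ z, ((imhAcceptE w x z +
          ∫⁻ y₁, ENNReal.ofReal (min (1 - imhAccept w x y₁) (w z * (1 - imhAccept w z y₁) / w x)) ∂q) +
        ∫⁻ η, min (ENNReal.ofReal ((1 - imhAccept w x η.1) - min (1 - imhAccept w x η.1) (w η.2 * (1 - imhAccept w η.2 η.1) / w x)))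
          (ENNReal.ofReal (w z / w x) *
            ENNReal.ofReal ((1 - imhAccept w z η.1) - min (1 - imhAccept w z η.1) (w η.2 * (1 - imhAccept w η.2 η.1) / w z)))
          ∂(q.prod q)) ∂q) * B.indicator 1 x) :
    Kernel.Invariant K (q.withDensity fun x => ENNReal.ofReal (w x)) :=
  (threeStage_isReversible hw hw0 K hK).invariant

/-! ## §3 The landing mass is at most one -/

/-- **THE THIRD STAGE COSTS AT MOST THE TWO-STAGE RESIDUAL**: `∫∫ d₃(x; η; z) dη dq(z) ≤ ∫ r(x; η) dη`. [ours] -/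
theorem threeStage_third_le (hw : Measurable w) (x : Ω) :
    ∫⁻ z, ∫⁻ η, min (ENNReal.ofReal ((1 - imhAccept w x η.1) - min (1 - imhAccept w x η.1) (w η.2 * (1 - imhAccept w η.2 η.1) / w x)))
          (ENNReal.ofReal (w z / w x) *
            ENNReal.ofReal ((1 - imhAccept w z η.1) - min (1 - imhAccept w z η.1) (w η.2 * (1 - imhAccept w η.2 η.1) / w z)))
          ∂(q.prod q) ∂q ≤
      ∫⁻ η, ENNReal.ofReal ((1 - imhAccept w x η.1) - min (1 - imhAccept w x η.1) (w η.2 * (1 - imhAccept w η.2 η.1) / w x)) ∂(q.prod q) := by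
  have _ := hw
  calc _ ≤ ∫⁻ _z, ∫⁻ η, ENNReal.ofReal ((1 - imhAccept w x η.1) -
          min (1 - imhAccept w x η.1) (w η.2 * (1 - imhAccept w η.2 η.1) / w x)) ∂(q.prod q) ∂q :=
        lintegral_mono fun z => lintegral_mono fun η => min_le_left _ _
    _ = _ := by rw [lintegral_const, measure_univ, mul_one]

/-- **THE LANDING MASS IS AT MOST ONE**: `A + ∫∫ d₂ + ∫∫∫ d₃ ≤ A + ∫∫ (d₂ + r) = A + (1 − A) = 1`. [ours] -/
theorem threeStage_mass_le_one (hw : Measurable w) (hw0 : ∀ x, 0 < w x) (x : Ω) :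
    ∫⁻ z, ((imhAcceptE w x z +
          ∫⁻ y₁, ENNReal.ofReal (min (1 - imhAccept w x y₁) (w z * (1 - imhAccept w z y₁) / w x)) ∂q) +
        ∫⁻ η, min (ENNReal.ofReal ((1 - imhAccept w x η.1) - min (1 - imhAccept w x η.1) (w η.2 * (1 - imhAccept w η.2 η.1) / w x)))
          (ENNReal.ofReal (w z / w x) *
            ENNReal.ofReal ((1 - imhAccept w z η.1) - min (1 - imhAccept w z η.1) (w η.2 * (1 - imhAccept w η.2 η.1) / w z)))
          ∂(q.prod q)) ∂q ≤ 1 := by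
  have ha : Measurable fun z => imhAcceptE w x z := (measurable_imhAcceptE hw).of_uncurry_left
  have hD : Measurable (Function.uncurry fun x z : Ω => imhAcceptE w x z +
      ∫⁻ y₁, ENNReal.ofReal (min (1 - imhAccept w x y₁) (w z * (1 - imhAccept w z y₁) / w x)) ∂q) := measurable_drDensity q hw
  have hd2 : Measurable fun η : Ω × Ω => ENNReal.ofReal (min (1 - imhAccept w x η.1) (w η.2 * (1 - imhAccept w η.2 η.1) / w x)) :=
    (measurable_drSecond hw).comp (measurable_const.prodMk measurable_id)
  -- split the landing density and bound the third stage by the residual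
  rw [lintegral_add_left hD.of_uncurry_left, lintegral_add_left ha, ← lintegral_lintegral_drSecond_swap hw x]
  -- `∫∫ d₂` over `y₁` then `y₂` equals the `q ⊗ q` integral of `d₂`
  have hd2prod : ∫⁻ y₁, ∫⁻ y₂, ENNReal.ofReal (min (1 - imhAccept w x y₁) (w y₂ * (1 - imhAccept w y₂ y₁) / w x)) ∂q ∂q =
      ∫⁻ η, ENNReal.ofReal (min (1 - imhAccept w x η.1) (w η.2 * (1 - imhAccept w η.2 η.1) / w x)) ∂(q.prod q) :=
    (lintegral_prod _ hd2.aemeasurable).symm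
  rw [hd2prod]
  calc ∫⁻ z, imhAcceptE w x z ∂q +
        ∫⁻ η, ENNReal.ofReal (min (1 - imhAccept w x η.1) (w η.2 * (1 - imhAccept w η.2 η.1) / w x)) ∂(q.prod q) + _
      ≤ ∫⁻ z, imhAcceptE w x z ∂q +
        ∫⁻ η, ENNReal.ofReal (min (1 - imhAccept w x η.1) (w η.2 * (1 - imhAccept w η.2 η.1) / w x)) ∂(q.prod q) +
        ∫⁻ η, ENNReal.ofReal ((1 - imhAccept w x η.1) -
          min (1 - imhAccept w x η.1) (w η.2 * (1 - imhAccept w η.2 η.1) / w x)) ∂(q.prod q) :=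
        add_le_add le_rfl (threeStage_third_le hw x)
    _ = ∫⁻ z, imhAcceptE w x z ∂q + ∫⁻ η, (1 - imhAcceptE w x η.1) ∂(q.prod q) := by
        rw [add_assoc, ← lintegral_add_left hd2]
        congr 1
        refine lintegral_congr fun η => ?_
        rw [add_comm, residual₂_add_drSecond hw0]
    _ = ∫⁻ z, imhAcceptE w x z ∂q + ∫⁻ y₁, (1 - imhAcceptE w x y₁) ∂q := by
        congr 1
        have hm : Measurable fun η : Ω × Ω => 1 - imhAcceptE w x η.1 := measurable_const.sub (ha.comp measurable_fst)
        rw [lintegral_prod _ hm.aemeasurable]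
        simp only [lintegral_const, measure_univ, mul_one]
    _ = ∫⁻ y₁, (imhAcceptE w x y₁ + (1 - imhAcceptE w x y₁)) ∂q := (lintegral_add_left ha _).symm
    _ = ∫⁻ _y₁, 1 ∂q := lintegral_congr fun y₁ => add_tsub_cancel_of_le (imhAcceptE_le_one w x y₁)
    _ = 1 := by rw [lintegral_const, measure_univ, mul_one]

end Summit.Ventures.LatticeQCDFlow.Exactness
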